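/-
Copyright (c) 2026 the pub-hodgecm-mathlib formalisation cell (harness21).  Prover seat hodgecm-mathlib-LH10-p01 (g11), 2026-09-03.  Road M6 «ROW 2 ★ DYADIC TWIN» → F3
«TOT-Λ BY OVER-ORDERS» (LEAD F0P3a-plan T14-66 ∕ T15-08), carve (c10b-S) «GATE AT b = 0, SUFFICIENCY» (F3-5 pen LH7-p04 (g12) 00:24:06Z; holder F0P3a-p02 (g27),
sigsheet SIG-c10b-S v1 ad4dff8922f419ee), split (S1) «K-LINE GRAM» (this file; offer 00:33:42Z, taken 00:34:02Z).
-/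
import Literature.NumberTheory.Automorphic.ReductiveGroupData   -- ★ `glInt n E = GL_n(𝒪)` (the docking currency of ★ L1 `exists_mem_unitary_span_eq_iff_selfDual`)
import HarnessLib

/-!
# The `K`-line Gram matrix at a product over-order: `[[ℓ(ν), ℓ(νΠ)], [ℓ(νΠ), ℓ(νΠ²)]] = [[0, 1], [1, ϖ^{N″}·a]]`

Topic `NumberTheory/Automorphic`; namespace `Literature.NumberTheory.Automorphic`.  THEOREMS ONLY (no definition, no instance, no notation, no named fact, no `sorry`);
kernel lane `--supports stmt-HodgeConjecture-24833`.  Cell `pub/hodgecm-mathlib` (D-0151), crux H413 = `stmt-HodgeConjecture-24833`; road M6 → F3 «TOT-Λ by over-orders»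
(route (B)), carve (c10b) «GATE AT GLUE DEPTH `b = 0`» for the F3-5 assembly (LH7-p04 (g12) F3-5a `OverOrderStrataTotal`, F3-5b): at the PRODUCT over-orders
`G₀(N″) = 𝒪_E × O_{N″}`, `O_{N″} = 𝒪_E[Π]`, `Π = ϖ^{N″}θ`, the stratum of self-dual `O`-cyclic lattices is non-empty iff class I (★ (c10b-N) p853089
`SelfDualProductOrderGate` = necessity).  The SUFFICIENCY half (holder F0P3a-p02 (g27), sigsheet SIG-c10b-S v1) builds, in class I, the witness basis
`g = [c₀x₀′ | φ(0, b₂)w₀ | φ(0, Π b₂)w₀]` with unimodular Gram matrix `diag(σ(c₀)c₀d₀, [[0, 1], [1, ϖ^{N″}a]])`; THIS FILE is its `K`-internal, model-free half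
(S1) «K-LINE GRAM»: the values of the `E`-linear functional `ℓ` (in the application `ℓ y = P(e₂, (0, y))`, `P` = ★ (c10b-N)'s pairing) on the `O_{N″}`-line through a
`b₂` with `b₂·σ_K(b₂) = ν`, and the `GL₃(𝒪)`-membership of the resulting block Gram matrix.
HONEST LABEL: HC_CM is proved only modulo the 7 printed citations (2 remaining named inputs: hLiu418 = stmt-HodgeConjecture-24832, h413 = stmt-HodgeConjecture-24833) until
rung 0 closes; high-school algebra in a quadratic algebra `K = E[θ]`, asserts nothing printed; count-neutral (zero label movement until F5 ★ and a desk-priced rider).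

FRAME (SIG-c10b-S v1 (S1), letters VERBATIM where the sheet fixes them).  `E ⊆ K` fields (`[Algebra E K]`); `θ : K` with `θ·θ = a·θ + k` (`a k : E`; the Eisenstein
letters of ★ F3-1a `GluedOverOrders` read in `K`); an additive, `E`-homogeneous functional `ℓ : K → E` (`hadd`, `hsmul` — so that the consumer may pass the bare
function `y ↦ P(e₂, (0, y))`), its two values `l₀ = ℓ 1`, `l₁ = ℓ θ` (`hl₀`, `hl₁`); `ϖ : E`, `N″ : ℕ`.  For §2: ring maps `σ : E → E`, `σ_K : K → K` with `σ_K ∘ algebraMap =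
algebraMap ∘ σ` (`hσKE`), `σ_K θ = θ` (`hσKθ`), and `σ`-FIXED `l₀, l₁, a, k, ϖ` (`hσl₀ hσl₁ hσa hσk hσϖ`; in the application `l₀, l₁` are `σ`-fixed by hermitian symmetry,
`a, k` by `σ_K θ = θ` and unique coordinates — see `kLine_map_eq_and_map_eq_of_coord` — and `ϖ ∈ F`).  INLINE TOKENS (no `def`):
`ν⋆ := algebraMap l₁ − algebraMap l₀·θ`, `Nν⋆ := l₁² − a·l₀·l₁ − k·l₀²` (`= ℓ(ν⋆θ)`), `Π := algebraMap(ϖ^{N″})·θ`, `ν := algebraMap((ϖ^{N″}·Nν⋆)⁻¹)·ν⋆`.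

THE MATHEMATICS (one paragraph, = the sheet's).  `ℓ(ν⋆) = l₁l₀ − l₀l₁ = 0`; `ν⋆θ = −k l₀ + (l₁ − a l₀)θ` (by `θ² = aθ + k`), so `ℓ(ν⋆θ) = l₁² − a l₀l₁ − k l₀² = Nν⋆`, and
`ν⋆θ² = (l₁ − a l₀)k + (−k l₀ + (l₁ − a l₀)a)θ` gives `ℓ(ν⋆θ²) = a·Nν⋆`.  Dividing by `ϖ^{N″}Nν⋆`: `ℓ(ν) = 0`, `ℓ(νΠ) = 1`, `ℓ(νΠ²) = ϖ^{N″}a`.  If `b₂·σ_K b₂ = ν` then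
(`σ_K Π = Π`) the Gram matrix of `T(x, x′) = ℓ(σ_K(x)·x′)` on `(b₂, Πb₂)` is `[[ℓν, ℓ(νΠ)], [ℓ(νΠ), ℓ(νΠ²)]] = [[0, 1], [1, ϖ^{N″}a]]` — integral with determinant
`−1`; and for a unit `d` and an integer `x` the block matrix `diag(d, [[0, 1], [1, x]])` lies in `GL₃(𝒪)` (explicit inverse `diag(d⁻¹, [[−x, 1], [1, 0]])`).

* §1 `kLine_ell_zero`, `kLine_ell_neg`, `kLine_ell_sub`, `kLine_ell_algebraMap`, `kLine_ell_algebraMap_mul_theta`, `kLine_ell_coord`; `kLine_ell_nuStar`, `kLine_nuStar_mul_theta_eq`, `kLine_ell_nuStar_mul_theta`,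
  `kLine_nuStar_mul_theta_mul_theta_eq`, `kLine_ell_nuStar_mul_theta_mul_theta`; `kLine_ell_nu`, `kLine_ell_nu_mul_theta`, `kLine_ell_nu_mul_Pi`, `kLine_ell_nu_mul_Pi_mul_Pi`.
* §2 `kLine_map_nuStar`, `kLine_map_Pi`, `kLine_map_normNuStar`, `kLine_map_nu`, `kLine_map_eq_and_map_eq_of_coord`; **`kLine_gram_of_norm_eq`** (S1's head: the four
  values `0, 1, 1, ϖ^{N″}a`), **`kLine_gram_mem_integer_of_norm_eq`** (S1′: the same as «entries integral, determinant a unit», the (S3-W) binder shape).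
* §3 **`exists_mem_glInt_coe_eq_lineBlock`** (`diag(d, [[0,1],[1,x]]) ∈ GL₃(𝒪)` in ★ L1's docking currency `∃ J′ ∈ glInt 3 E, ↑J′ = …`).

## References
* [Jacobowitz1962] R. Jacobowitz, *Hermitian forms over local fields*, Amer. J. Math. 84 (1962): §4 (Gram matrices, unimodular = self-dual), §7.
* [Neukirch1999] J. Neukirch, *Algebraic Number Theory*, Grundlehren 322 (1999): Ch. I §12 (orders `𝒪[Π]` in a quadratic algebra; product orders).
* [Rogawski1990] J. D. Rogawski, *Automorphic Representations of Unitary Groups in Three Variables*, Ann. of Math. Stud. 123 (1990): §4.9 Lemma 4.9.3 p. 56, Prop. 4.9.1 (b)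
  p. 55 (where the self-dual lattice counts are consumed).
* [HornJohnson2013] R. A. Horn, C. R. Johnson, *Matrix Analysis* (2nd ed. 2013): §0.8 (block matrices and their inverses).
-/

set_option autoImplicit false

noncomputable section

open Matrix
open scoped ValuativeRel

namespace Literature.NumberTheory.Automorphic

/-! ## §1 The functional `ℓ` on the line `ν⋆ = l₁ − l₀θ` and on `ν, νΠ, νΠ²` -/

section KLine

variable {E K : Type*} [Field E] [Field K] [Algebra E K]
  (θ : K) {a k : E} (hθ : θ * θ = algebraMap E K a * θ + algebraMap E K k)
  (ℓ : K → E) (hadd : ∀ x y : K, ℓ (x + y) = ℓ x + ℓ y) (hsmul : ∀ (c : E) (y : K), ℓ (algebraMap E K c * y) = c * ℓ y)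
  {l₀ l₁ : E} (hl₀ : ℓ 1 = l₀) (hl₁ : ℓ θ = l₁)

include hsmul in
/-- `ℓ 0 = 0`. [cite: Jacobowitz1962, §4] -/
theorem kLine_ell_zero : ℓ 0 = 0 := by
  have h := hsmul 0 0
  rwa [map_zero, zero_mul, zero_mul] at h

include hadd hsmul in
/-- `ℓ (−x) = −ℓ x`. [cite: Jacobowitz1962, §4] -/
theorem kLine_ell_neg (x : K) : ℓ (-x) = -ℓ x := by
  have h := hadd x (-x)
  rw [add_neg_cancel, kLine_ell_zero ℓ hsmul] at h
  exact (neg_eq_of_add_eq_zero_right h.symm).symm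

include hadd hsmul in
/-- `ℓ (x − y) = ℓ x − ℓ y`. [cite: Jacobowitz1962, §4] -/
theorem kLine_ell_sub (x y : K) : ℓ (x - y) = ℓ x - ℓ y := by
  rw [sub_eq_add_neg, hadd, kLine_ell_neg ℓ hadd hsmul, ← sub_eq_add_neg]

include hsmul hl₀ in
/-- `ℓ (c) = c·l₀` for a scalar `c ∈ E`. [cite: Jacobowitz1962, §4] -/
theorem kLine_ell_algebraMap (c : E) : ℓ (algebraMap E K c) = c * l₀ := by
  rw [← hl₀, ← hsmul, mul_one]

include hsmul hl₁ in
/-- `ℓ (c·θ) = c·l₁` for a scalar `c ∈ E`. [cite: Jacobowitz1962, §4] -/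
theorem kLine_ell_algebraMap_mul_theta (c : E) : ℓ (algebraMap E K c * θ) = c * l₁ := by
  rw [← hl₁, ← hsmul]

include hadd hsmul hl₀ hl₁ in
/-- **`ℓ` IN COORDINATES**: `ℓ (p + q·θ) = p·l₀ + q·l₁`. [cite: Jacobowitz1962, §4] -/
theorem kLine_ell_coord (p q : E) : ℓ (algebraMap E K p + algebraMap E K q * θ) = p * l₀ + q * l₁ := by
  rw [hadd, kLine_ell_algebraMap ℓ hsmul hl₀, kLine_ell_algebraMap_mul_theta θ ℓ hsmul hl₁]

include hadd hsmul hl₀ hl₁ in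
/-- **`ℓ(ν⋆) = 0`** for `ν⋆ := l₁ − l₀·θ` (`= l₁l₀ − l₀l₁`): the line `E·ν⋆` is `ℓ`-isotropic. [cite: Jacobowitz1962, §4] -/
theorem kLine_ell_nuStar : ℓ (algebraMap E K l₁ - algebraMap E K l₀ * θ) = 0 := by
  rw [kLine_ell_sub ℓ hadd hsmul, kLine_ell_algebraMap ℓ hsmul hl₀, kLine_ell_algebraMap_mul_theta θ ℓ hsmul hl₁]
  ring

include hθ in
/-- `ν⋆·θ = −k·l₀ + (l₁ − a·l₀)·θ` (from `θ² = aθ + k`). [cite: Neukirch1999, Ch. I §12] -/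
theorem kLine_nuStar_mul_theta_eq :
    (algebraMap E K l₁ - algebraMap E K l₀ * θ) * θ = algebraMap E K (-(k * l₀)) + algebraMap E K (l₁ - a * l₀) * θ := by
  rw [map_neg, map_mul, map_sub, map_mul]
  linear_combination (-(algebraMap E K l₀)) * hθ

include hθ hadd hsmul hl₀ hl₁ in
/-- **`ℓ(ν⋆θ) = Nν⋆ := l₁² − a·l₀·l₁ − k·l₀²`** (the `K∕E`-norm form of `ν⋆`, written without the Galois conjugation). [cite: Neukirch1999, Ch. I §12] -/
theorem kLine_ell_nuStar_mul_theta : ℓ ((algebraMap E K l₁ - algebraMap E K l₀ * θ) * θ) = l₁ ^ 2 - a * l₀ * l₁ - k * l₀ ^ 2 := by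
  rw [kLine_nuStar_mul_theta_eq θ hθ, kLine_ell_coord θ ℓ hadd hsmul hl₀ hl₁]
  ring

include hθ in
/-- `ν⋆·θ·θ = (l₁ − a l₀)·k + (−k l₀ + (l₁ − a l₀)·a)·θ`. [cite: Neukirch1999, Ch. I §12] -/
theorem kLine_nuStar_mul_theta_mul_theta_eq :
    (algebraMap E K l₁ - algebraMap E K l₀ * θ) * θ * θ =
      algebraMap E K ((l₁ - a * l₀) * k) + algebraMap E K (-(k * l₀) + (l₁ - a * l₀) * a) * θ := by
  rw [map_mul, map_sub, map_mul, map_add, map_neg, map_mul, map_mul, map_sub, map_mul]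
  linear_combination (-(algebraMap E K l₀) * θ + (algebraMap E K l₁ - algebraMap E K a * algebraMap E K l₀)) * hθ

include hθ hadd hsmul hl₀ hl₁ in
/-- `ℓ(ν⋆θ²) = a·Nν⋆`. [cite: Neukirch1999, Ch. I §12] -/
theorem kLine_ell_nuStar_mul_theta_mul_theta :
    ℓ ((algebraMap E K l₁ - algebraMap E K l₀ * θ) * θ * θ) = a * (l₁ ^ 2 - a * l₀ * l₁ - k * l₀ ^ 2) := by
  rw [kLine_nuStar_mul_theta_mul_theta_eq θ hθ, kLine_ell_coord θ ℓ hadd hsmul hl₀ hl₁]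
  ring

variable (ϖ : E) (N'' : ℕ)

include hadd hsmul hl₀ hl₁ in
/-- **`ℓ(ν) = 0`** for `ν := (ϖ^{N″}·Nν⋆)⁻¹·ν⋆`. [cite: Jacobowitz1962, §4] -/
theorem kLine_ell_nu :
    ℓ (algebraMap E K (ϖ ^ N'' * (l₁ ^ 2 - a * l₀ * l₁ - k * l₀ ^ 2))⁻¹ * (algebraMap E K l₁ - algebraMap E K l₀ * θ)) = 0 := by
  rw [hsmul, kLine_ell_nuStar θ ℓ hadd hsmul hl₀ hl₁, mul_zero]

include hθ hadd hsmul hl₀ hl₁ in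
/-- `ℓ(ν·θ) = (ϖ^{N″})⁻¹` (`Nν⋆ ≠ 0`). [cite: Jacobowitz1962, §4] -/
theorem kLine_ell_nu_mul_theta (hN : l₁ ^ 2 - a * l₀ * l₁ - k * l₀ ^ 2 ≠ 0) :
    ℓ (algebraMap E K (ϖ ^ N'' * (l₁ ^ 2 - a * l₀ * l₁ - k * l₀ ^ 2))⁻¹ * (algebraMap E K l₁ - algebraMap E K l₀ * θ) * θ) = (ϖ ^ N'')⁻¹ := by
  rw [mul_assoc, hsmul, kLine_ell_nuStar_mul_theta θ hθ ℓ hadd hsmul hl₀ hl₁, mul_inv, inv_mul_cancel_right₀ hN]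

include hθ hadd hsmul hl₀ hl₁ in
/-- **`ℓ(ν·Π) = 1`** for `Π := ϖ^{N″}·θ` (`Nν⋆ ≠ 0`, `ϖ ≠ 0`). [cite: Jacobowitz1962, §4] [cite: Neukirch1999, Ch. I §12] -/
theorem kLine_ell_nu_mul_Pi (hϖ : ϖ ≠ 0) (hN : l₁ ^ 2 - a * l₀ * l₁ - k * l₀ ^ 2 ≠ 0) :
    ℓ (algebraMap E K (ϖ ^ N'' * (l₁ ^ 2 - a * l₀ * l₁ - k * l₀ ^ 2))⁻¹ * (algebraMap E K l₁ - algebraMap E K l₀ * θ) *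
        (algebraMap E K (ϖ ^ N'') * θ)) = 1 := by
  have h : algebraMap E K (ϖ ^ N'' * (l₁ ^ 2 - a * l₀ * l₁ - k * l₀ ^ 2))⁻¹ * (algebraMap E K l₁ - algebraMap E K l₀ * θ) *
      (algebraMap E K (ϖ ^ N'') * θ) =
      algebraMap E K ((ϖ ^ N'' * (l₁ ^ 2 - a * l₀ * l₁ - k * l₀ ^ 2))⁻¹ * ϖ ^ N'') * ((algebraMap E K l₁ - algebraMap E K l₀ * θ) * θ) := by
    rw [map_mul]; ring
  rw [h, hsmul, kLine_ell_nuStar_mul_theta θ hθ ℓ hadd hsmul hl₀ hl₁, mul_assoc, inv_mul_cancel₀ (mul_ne_zero (pow_ne_zero _ hϖ) hN)]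

include hθ hadd hsmul hl₀ hl₁ in
/-- **`ℓ(ν·Π·Π) = ϖ^{N″}·a`** (`Nν⋆ ≠ 0`, `ϖ ≠ 0`). [cite: Jacobowitz1962, §4] [cite: Neukirch1999, Ch. I §12] -/
theorem kLine_ell_nu_mul_Pi_mul_Pi (hϖ : ϖ ≠ 0) (hN : l₁ ^ 2 - a * l₀ * l₁ - k * l₀ ^ 2 ≠ 0) :
    ℓ (algebraMap E K (ϖ ^ N'' * (l₁ ^ 2 - a * l₀ * l₁ - k * l₀ ^ 2))⁻¹ * (algebraMap E K l₁ - algebraMap E K l₀ * θ) *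
        (algebraMap E K (ϖ ^ N'') * θ) * (algebraMap E K (ϖ ^ N'') * θ)) = ϖ ^ N'' * a := by
  have h : algebraMap E K (ϖ ^ N'' * (l₁ ^ 2 - a * l₀ * l₁ - k * l₀ ^ 2))⁻¹ * (algebraMap E K l₁ - algebraMap E K l₀ * θ) *
      (algebraMap E K (ϖ ^ N'') * θ) * (algebraMap E K (ϖ ^ N'') * θ) =
      algebraMap E K ((ϖ ^ N'' * (l₁ ^ 2 - a * l₀ * l₁ - k * l₀ ^ 2))⁻¹ * ϖ ^ N'' * ϖ ^ N'') *
        ((algebraMap E K l₁ - algebraMap E K l₀ * θ) * θ * θ) := by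
    rw [map_mul, map_mul]; ring
  rw [h, hsmul, kLine_ell_nuStar_mul_theta_mul_theta θ hθ ℓ hadd hsmul hl₀ hl₁]
  have h0 : ϖ ^ N'' * (l₁ ^ 2 - a * l₀ * l₁ - k * l₀ ^ 2) ≠ 0 := mul_ne_zero (pow_ne_zero _ hϖ) hN
  have e : (ϖ ^ N'' * (l₁ ^ 2 - a * l₀ * l₁ - k * l₀ ^ 2))⁻¹ * ϖ ^ N'' * ϖ ^ N'' * (a * (l₁ ^ 2 - a * l₀ * l₁ - k * l₀ ^ 2)) =
      (ϖ ^ N'' * (l₁ ^ 2 - a * l₀ * l₁ - k * l₀ ^ 2))⁻¹ * (ϖ ^ N'' * (l₁ ^ 2 - a * l₀ * l₁ - k * l₀ ^ 2)) * (ϖ ^ N'' * a) := by ring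
  rw [e, inv_mul_cancel₀ h0, one_mul]

/-! ## §2 The involutions: `σ_K` fixes `ν⋆, Π, ν`; the Gram matrix of the `O_{N″}`-line through `b₂` with `b₂·σ_K b₂ = ν` -/

variable (σ : E →+* E) (σK : K →+* K) (hσKE : ∀ y : E, σK (algebraMap E K y) = algebraMap E K (σ y)) (hσKθ : σK θ = θ)
  (hσl₀ : σ l₀ = l₀) (hσl₁ : σ l₁ = l₁) (hσa : σ a = a) (hσk : σ k = k) (hσϖ : σ ϖ = ϖ)

include hσKE hσKθ hσl₀ hσl₁ in
/-- `σ_K(ν⋆) = ν⋆` (`l₀, l₁` are `σ`-fixed, `σ_K θ = θ`). [cite: Jacobowitz1962, §4] -/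
theorem kLine_map_nuStar : σK (algebraMap E K l₁ - algebraMap E K l₀ * θ) = algebraMap E K l₁ - algebraMap E K l₀ * θ := by
  rw [map_sub, map_mul, hσKE, hσKE, hσKθ, hσl₀, hσl₁]

include hσKE hσKθ hσϖ in
/-- `σ_K(Π) = Π` for `Π = ϖ^{N″}θ` (`ϖ` is `σ`-fixed). [cite: Neukirch1999, Ch. I §12] -/
theorem kLine_map_Pi : σK (algebraMap E K (ϖ ^ N'') * θ) = algebraMap E K (ϖ ^ N'') * θ := by
  rw [map_mul, hσKE, hσKθ, map_pow, hσϖ]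

include hσl₀ hσl₁ hσa hσk in
/-- `σ(Nν⋆) = Nν⋆`. [cite: Neukirch1999, Ch. I §12] -/
theorem kLine_map_normNuStar : σ (l₁ ^ 2 - a * l₀ * l₁ - k * l₀ ^ 2) = l₁ ^ 2 - a * l₀ * l₁ - k * l₀ ^ 2 := by
  simp only [map_sub, map_mul, map_pow, hσl₀, hσl₁, hσa, hσk]

include hσKE hσKθ hσl₀ hσl₁ hσa hσk hσϖ in
/-- **`σ_K(ν) = ν`**: the target of the norm equation `b₂·σ_K b₂ = ν` is `σ_K`-fixed (the input shape of the norm-supply lemmas of (S2) `QuadraticFixedNormSupply`).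
[cite: Jacobowitz1962, §4] [cite: Neukirch1999, Ch. I §12] -/
theorem kLine_map_nu :
    σK (algebraMap E K (ϖ ^ N'' * (l₁ ^ 2 - a * l₀ * l₁ - k * l₀ ^ 2))⁻¹ * (algebraMap E K l₁ - algebraMap E K l₀ * θ)) =
      algebraMap E K (ϖ ^ N'' * (l₁ ^ 2 - a * l₀ * l₁ - k * l₀ ^ 2))⁻¹ * (algebraMap E K l₁ - algebraMap E K l₀ * θ) := by
  rw [map_mul σK, kLine_map_nuStar θ σ σK hσKE hσKθ hσl₀ hσl₁, hσKE, map_inv₀ σ, map_mul σ, map_pow σ, hσϖ, kLine_map_normNuStar σ hσl₀ hσl₁ hσa hσk]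

include hθ hσKE hσKθ in
/-- **`a, k` ARE `σ`-FIXED** as soon as `σ_K θ = θ` and the coordinates on `(1, θ)` are unique: apply `σ_K` to `θ² = aθ + k`. [cite: Neukirch1999, Ch. I §12] -/
theorem kLine_map_eq_and_map_eq_of_coord (hcoordK : ∀ y : K, ∃! pq : E × E, y = algebraMap E K pq.1 + algebraMap E K pq.2 * θ) :
    σ a = a ∧ σ k = k := by
  have h1 : θ * θ = algebraMap E K k + algebraMap E K a * θ := by rw [hθ, add_comm]
  have h2 : θ * θ = algebraMap E K (σ k) + algebraMap E K (σ a) * θ := by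
    have h := congrArg σK hθ
    rw [map_mul, map_add, map_mul, hσKE, hσKE, hσKθ] at h
    rw [h, add_comm]
  have huniq := (hcoordK (θ * θ)).unique (y₁ := (σ k, σ a)) (y₂ := (k, a)) h2 h1
  exact ⟨congrArg Prod.snd huniq, congrArg Prod.fst huniq⟩

include hθ hadd hsmul hl₀ hl₁ hσKE hσKθ hσϖ in
/-- **(S1) THE `K`-LINE GRAM MATRIX.**  If `b₂·σ_K(b₂) = ν := (ϖ^{N″}·Nν⋆)⁻¹·(l₁ − l₀θ)` (`Nν⋆ = l₁² − a l₀l₁ − k l₀² ≠ 0`, `ϖ ≠ 0`), then for `Π := ϖ^{N″}θ` the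
Gram matrix of the `E`-valued form `T(x, x′) = ℓ(σ_K(x)·x′)` on the `O_{N″}`-basis `(b₂, Π·b₂)` of the line `O_{N″}·b₂` is
`[[T(b₂,b₂), T(b₂,Πb₂)], [T(Πb₂,b₂), T(Πb₂,Πb₂)]] = [[0, 1], [1, ϖ^{N″}·a]]` — INTEGRAL WITH DETERMINANT `−1` when `a, ϖ ∈ 𝒪`: the `K`-plane summand of the witness lattice
at the product over-order `𝒪_E × O_{N″}` is self-dual (the (c10b-S) witness; `c₀`, `b₂` and the assembly are F0P3a-p02's (S3)). [cite: Jacobowitz1962, §4, §7]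
[cite: Neukirch1999, Ch. I §12] [cite: Rogawski1990, §4.9 Lemma 4.9.3 p. 56] -/
theorem kLine_gram_of_norm_eq (hϖ : ϖ ≠ 0) (hN : l₁ ^ 2 - a * l₀ * l₁ - k * l₀ ^ 2 ≠ 0) (b₂ : K)
    (hb₂ : b₂ * σK b₂ = algebraMap E K (ϖ ^ N'' * (l₁ ^ 2 - a * l₀ * l₁ - k * l₀ ^ 2))⁻¹ * (algebraMap E K l₁ - algebraMap E K l₀ * θ)) :
    ℓ (σK b₂ * b₂) = 0 ∧
      ℓ (σK b₂ * (algebraMap E K (ϖ ^ N'') * θ * b₂)) = 1 ∧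
        ℓ (σK (algebraMap E K (ϖ ^ N'') * θ * b₂) * b₂) = 1 ∧
          ℓ (σK (algebraMap E K (ϖ ^ N'') * θ * b₂) * (algebraMap E K (ϖ ^ N'') * θ * b₂)) = ϖ ^ N'' * a := by
  have hν : σK b₂ * b₂ = algebraMap E K (ϖ ^ N'' * (l₁ ^ 2 - a * l₀ * l₁ - k * l₀ ^ 2))⁻¹ * (algebraMap E K l₁ - algebraMap E K l₀ * θ) := by
    rw [mul_comm, hb₂]
  have hPi := kLine_map_Pi θ ϖ N'' σ σK hσKE hσKθ hσϖ
  refine ⟨?_, ?_, ?_, ?_⟩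
  · rw [hν, kLine_ell_nu θ ℓ hadd hsmul hl₀ hl₁ ϖ N'']
  · have h : σK b₂ * (algebraMap E K (ϖ ^ N'') * θ * b₂) = σK b₂ * b₂ * (algebraMap E K (ϖ ^ N'') * θ) := by ring
    rw [h, hν, kLine_ell_nu_mul_Pi θ hθ ℓ hadd hsmul hl₀ hl₁ ϖ N'' hϖ hN]
  · have h : σK (algebraMap E K (ϖ ^ N'') * θ * b₂) * b₂ = σK b₂ * b₂ * (algebraMap E K (ϖ ^ N'') * θ) := by rw [map_mul, hPi]; ring
    rw [h, hν, kLine_ell_nu_mul_Pi θ hθ ℓ hadd hsmul hl₀ hl₁ ϖ N'' hϖ hN]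
  · have h : σK (algebraMap E K (ϖ ^ N'') * θ * b₂) * (algebraMap E K (ϖ ^ N'') * θ * b₂) =
        σK b₂ * b₂ * (algebraMap E K (ϖ ^ N'') * θ) * (algebraMap E K (ϖ ^ N'') * θ) := by rw [map_mul, hPi]; ring
    rw [h, hν, kLine_ell_nu_mul_Pi_mul_Pi θ hθ ℓ hadd hsmul hl₀ hl₁ ϖ N'' hϖ hN]

include hθ hadd hsmul hl₀ hl₁ hσKE hσKθ hσϖ in
/-- **(S1′) THE `K`-LINE GRAM MATRIX IS UNIMODULAR** — the same in the binder currency of F0P3a-p02 (g27)'s (S3-W) `exists_selfDual_cyclicOver_map_of_kPlane_gram`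
(`h00 h01 h10 h11`: the four entries are INTEGRAL; `hdet`: `|T₀₀T₁₁ − T₀₁T₁₀| = 1`), when `a, ϖ ∈ 𝒪_E`: the entries are `0, 1, 1, ϖ^{N″}a ∈ 𝒪` and the determinant is `−1`.
[cite: Jacobowitz1962, §4, §7] [cite: Rogawski1990, §4.9 Lemma 4.9.3 p. 56] -/
theorem kLine_gram_mem_integer_of_norm_eq [ValuativeRel E] (ha : a ∈ 𝒪[E]) (hϖO : ϖ ∈ 𝒪[E]) (hϖ : ϖ ≠ 0)
    (hN : l₁ ^ 2 - a * l₀ * l₁ - k * l₀ ^ 2 ≠ 0) (b₂ : K)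
    (hb₂ : b₂ * σK b₂ = algebraMap E K (ϖ ^ N'' * (l₁ ^ 2 - a * l₀ * l₁ - k * l₀ ^ 2))⁻¹ * (algebraMap E K l₁ - algebraMap E K l₀ * θ)) :
    ℓ (σK b₂ * b₂) ∈ 𝒪[E] ∧
      ℓ (σK b₂ * (algebraMap E K (ϖ ^ N'') * θ * b₂)) ∈ 𝒪[E] ∧
        ℓ (σK (algebraMap E K (ϖ ^ N'') * θ * b₂) * b₂) ∈ 𝒪[E] ∧
          ℓ (σK (algebraMap E K (ϖ ^ N'') * θ * b₂) * (algebraMap E K (ϖ ^ N'') * θ * b₂)) ∈ 𝒪[E] ∧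
            ValuativeRel.valuation E
              (ℓ (σK b₂ * b₂) * ℓ (σK (algebraMap E K (ϖ ^ N'') * θ * b₂) * (algebraMap E K (ϖ ^ N'') * θ * b₂)) -
                ℓ (σK b₂ * (algebraMap E K (ϖ ^ N'') * θ * b₂)) * ℓ (σK (algebraMap E K (ϖ ^ N'') * θ * b₂) * b₂)) = 1 := by
  obtain ⟨h00, h01, h10, h11⟩ := kLine_gram_of_norm_eq θ hθ ℓ hadd hsmul hl₀ hl₁ ϖ N'' σ σK hσKE hσKθ hσϖ hϖ hN b₂ hb₂
  rw [h00, h01, h10, h11]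
  refine ⟨Subring.zero_mem _, Subring.one_mem _, Subring.one_mem _, Subring.mul_mem _ (Subring.pow_mem _ hϖO _) ha, ?_⟩
  rw [zero_mul, mul_one, zero_sub, Valuation.map_neg, map_one]

end KLine

/-! ## §3 The block Gram matrix `diag(d, [[0, 1], [1, x]])` lies in `GL₃(𝒪)` -/

section Block

variable {E : Type*} [Field E] [ValuativeRel E]

/-- **`diag(d, [[0, 1], [1, x]]) ∈ GL₃(𝒪)`** for a unit `d` (`|d| = 1`) and an integer `x` — explicit inverse `diag(d⁻¹, [[−x, 1], [1, 0]])`; in ★ L1's docking currency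
`∃ J′ ∈ glInt 3 E, ↑J′ = …` (★ `exists_mem_unitary_span_eq_iff_selfDual`): a basis with this Gram matrix spans a SELF-DUAL lattice. [cite: Jacobowitz1962, §4, §7]
[cite: HornJohnson2013, §0.8] -/
theorem exists_mem_glInt_coe_eq_lineBlock (d x : E) (hd : ValuativeRel.valuation E d = 1) (hx : x ∈ 𝒪[E]) :
    ∃ J' ∈ glInt 3 E, (J' : Matrix (Fin 3) (Fin 3) E) = !![d, 0, 0; 0, 0, 1; 0, 1, x] := by
  have hd0 : d ≠ 0 := fun h0 => by rw [h0, map_zero] at hd; exact zero_ne_one hd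
  have hdO : d ∈ 𝒪[E] := (Valuation.mem_integer_iff _ _).2 hd.le
  have hdO' : d⁻¹ ∈ 𝒪[E] := (Valuation.mem_integer_iff _ _).2 (by rw [map_inv₀, hd, inv_one])
  set dO : 𝒪[E] := ⟨d, hdO⟩ with hdOdef
  set dO' : 𝒪[E] := ⟨d⁻¹, hdO'⟩ with hdO'def
  set xO : 𝒪[E] := ⟨x, hx⟩ with hxOdef
  have hdd : dO * dO' = 1 := Subtype.ext (mul_inv_cancel₀ hd0)
  have hdd' : dO' * dO = 1 := Subtype.ext (inv_mul_cancel₀ hd0)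
  set M : Matrix (Fin 3) (Fin 3) 𝒪[E] := !![dO, 0, 0; 0, 0, 1; 0, 1, xO] with hM
  set M' : Matrix (Fin 3) (Fin 3) 𝒪[E] := !![dO', 0, 0; 0, -xO, 1; 0, 1, 0] with hM'
  have hMM' : M * M' = 1 := by
    ext i j
    fin_cases i <;> fin_cases j <;> simp [hM, hM', Matrix.mul_apply, Fin.sum_univ_three, hdd]
  have hM'M : M' * M = 1 := by
    ext i j
    fin_cases i <;> fin_cases j <;> simp [hM, hM', Matrix.mul_apply, Fin.sum_univ_three, hdd']
  let g : GL (Fin 3) 𝒪[E] := ⟨M, M', hMM', hM'M⟩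
  refine ⟨Matrix.GeneralLinearGroup.map (𝒪[E]).subtype g, ⟨g, rfl⟩, ?_⟩
  ext i j
  fin_cases i <;> fin_cases j <;> rfl

end Block

end Literature.NumberTheory.Automorphic

end
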